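import Summits.BirchSwinnertonDyer.Uniform.U2.SelmerControlKernel
import Summits.BirchSwinnertonDyer.Rank1Residual.P2.TwistInvarianceAtTwo
import Literature.NumberTheory.EllipticCurves.MazurRubin2010.TwistSelmerRankControl
import HarnessLib

/-!
# Track U2, route A (cell `bsd-uniform`, seat u2-p1): DIRECT TRANSPORT of rank and `Ш[2^∞] = 0`
# through the PRINTED `2`-adic control theorem (Mazur–Rubin 2010, Cor. 3.4 (ii)), with the
# reduction-type hypotheses EXPLICIT and the residue named

HONEST FRAMING (cell `bsd-uniform`, HOME run/shared/lean/pub/bsd-uniform/, verbatim in every file of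
the seat): a RELATIVE ("twist-transport") theorem, uniform in the twisting parameter `d`, CONDITIONAL
per base curve on named invariants of the base (`E(ℚ)[2] = 0`, `Ш(E/ℚ)[2] = 0`, `rank E(ℚ) ≤ 1`) and
on ONE input about the twist (`Ш(E^{(d)}/ℚ)[2^∞]` finite — the output of the Heegner half of the
«a_q-odd combination at 2», assembled by seats u2-p2/u2-p3, or of Gross–Zagier–Kolyvagin when
`r_an(E^{(d)}) ≤ 1`). It converts PAIRS, never the class X5; it books nothing and moves no census
number; no per-curve certificate is counted as a uniform theorem. Its only non-kernel input is the
PUBLISHED control theorem, taken BY NAME as a hypothesis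
(`Literature.NumberTheory.EllipticCurves.MazurRubin2010.cor34ii_rat`, Invent. Math. 181 (2010)
Cor. 3.4 (ii), typed AS PRINTED, `K = ℚ`), plus the tree's Cassels–Tate named fact
`exists_casselsTate_pairing`. What is PROVED here is the assembly: control (`d₂(E^{(d)}) = d₂(E)`)
+ twist-invariance of `E(ℚ)[2] = 0` (tree theorem `irr_two_iff_of_twist`) + the kernel
(`SelmerControlKernel`) ⇒ `rank E^{(d)}(ℚ) = rank E(ℚ)` and `Ш(E^{(d)}/ℚ)[2^∞] = 0`.

WHICH REDUCTION TYPES ARE COVERED (= the binders of Mazur–Rubin's Prop. 3.3 over `ℚ`, explicit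
below; `F = ℚ(√d)`): every prime `ℓ` of ADDITIVE reduction of `E` must split in `F`
(`d ∈ ℚ_ℓ^{×2}`); every prime of MULTIPLICATIVE reduction with `ord_ℓ(Δ_E)` EVEN must split in
`F`; `2` must split in `F` (`d ≡ 1 (mod 8)`); the real place must split when `Δ_E > 0` (`d > 0`);
multiplicative primes with `ord_ℓ(Δ_E)` odd must be unramified (automatic for `d` coprime to `N`);
and every prime `q` ramified in `F` (the prime factors of `d`) must have `E(ℚ_q)[2] = 0` — for
`q ∤ 2N` this is exactly «`a_q(E)` odd» (T4-PROOF §1; INGREDIENTS.md §7 F9), the a_q-ODD class.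
RESIDUE OF ROUTE A (named; HOME/RESIDUE.md): (R-A1) additive `ℓ ∣ N` with `d ∉ ℚ_ℓ^{×2}`
[Kramer–Tunnell 1982 §6 prints `δ_ℓ = 0` for the odd-`c` types I₀, II, II*, IV, IV* at an
UNRAMIFIED `ℓ` — beyond Mazur–Rubin's printed binder; an extension theorem needs their Lemma 6.1
proof + MR Lemma 2.9, typed]; (R-A2) multiplicative `ℓ` with `ord_ℓ(Δ)` even and `d ∉ ℚ_ℓ^{×2}`
(genuine: `δ_ℓ` can be `1`); (R-A3) `d ≡ 5 (mod 8)` with `2 ∤ N` [MR Lemma 2.10 (v) covers it, but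
Prop. 3.3 as printed asks `2` split]; (R-A4) `Δ_E > 0 ∧ d < 0` (`h_∞ = 1`: genuine, the rank
FLIPS — T4-PROOF Remark 6.2); (R-A5) bases with `E(ℚ)[2] ≠ 0` (the Borel column: Cai–Li–Zhai /
Shu–Zhai territory), `Ш(E)[2] ≠ 0`, or `rank E ≥ 2`; (R-A6) the finiteness input itself when no
Heegner field with `y_K ∉ 2E(K)` is available.

## Contents

* `torsionBy_two_eq_bot_iff` — `E(ℚ)[2] = ⊥ ⟺ (2 • P = 0 → P = 0)` (bookkeeping).
* `torsionBy_two_eq_bot_of_twist` — `E(ℚ)[2] = 0 ⇒ E^{(d)}(ℚ)[2] = 0` (tree theorem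
  `irr_two_iff_of_twist` + `X5.O1.irr_two_iff_forall_two_nsmul`).
* `routeA_rank_eq_and_sha_two_eq_bot` — THE ROUTE-A TRANSPORT THEOREM (finiteness input).
* `routeA_rank_eq_and_sha_two_eq_bot_of_rank_le` — variant: a point of infinite order on the twist
  instead of finiteness (then `Ш(E^{(d)})[2^∞] = 0` and its finiteness are outputs).
* `routeA_rank_zero` — rank-`0` bases: NO finiteness input and NO Cassels–Tate
  (`Sel₂(E^{(d)}) = 0`); this is the half that Zhai 2016 reaches analytically.
* `routeA_pair` — both members of a genus pair `(E^{(d)}, E^{(dD)})`: the rank distribution of the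
  base pair `(E, E^{(D)})` transports (the rank statement of T4-PROOF Thm A′ for `h_∞ = 0`) and both
  `Ш[2^∞]` vanish.
* `routeA_bsdp_two_iff_shaAn_unit` — the hand-over to the analytic side: with the finiteness input
  given as `r_an(E^{(d)}) ≤ 1` (+ GZK), `BSD(E^{(d)}, 2) ⟺ ord₂ #Ш_an(E^{(d)}) = 0`.

WHY THIS IS NOT IN PRINT AS SUCH (and what is). For `Sel₂(E) = 0` bases (rank `0`, `Ш(E)[2] = 0`,
`E(ℚ)[2] = 0`) the control conclusion `Sel₂(E^{(d)}) = 0` along "2-trivial" `d` is printed twice: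
Mazur–Rubin 2010 Prop. 4.2 (`0 < d ≡ 1 (mod 8Δ)`) and Boxer–Diao 2010 Thm 1.1 / 2.1 ("good" `E`: square-free
odd-`ord(Δ)` conductor, `Δ < 0`, good at `2` with `j ≡ 0 (2)`; any odd `d` prime to `Δ`) — so
`routeA_rank_zero` is a re-derivation inside Cor 3.4 (ii)'s binders, not a novelty. The rank-ONE base
case (`d₂(E) = 1`: `Sel₂(E^{(d)}) ≅ ℤ/2` forces rank `1` and `Ш[2] = 0` once `Ш(E^{(d)})[2^∞]` is
finite) is the part the p2 lane's write-up (T4-PROOF Thm B′) marks ⟨R: assembly⟩ and the lit seats did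
not locate in print; it is what `routeA_rank_eq_and_sha_two_eq_bot` proves, modulo the two named facts.

References: Mazur–Rubin, Invent. Math. 181 (2010) Prop. 3.3, Cor. 3.4 (ii), Prop. 4.2, Lemma 2.9–2.10
[MazurRubin2010]; Boxer–Diao, Proc. AMS 138 (2010) Thm. 1.1 / 2.1 [BoxerDiao2010]; Kramer, Trans. AMS 264 (1981) Props. 1, 2(a), 6, 7 [Kramer1981]; Kramer–Tunnell,
Compositio 46 (1982) §6 Lemma 6.1 [KramerTunnell1982]; b2b p2/idea-2 T4-PROOF.md v1.9b §3 L4, §6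
Thm B′ (the write-up this assembles; EVIDENCE, not print); HOME/u2/INGREDIENTS.md §6–§7 (u2-lit).
-/

noncomputable section

open scoped Classical AddSubgroup

open NumberField WeierstrassCurve Literature.NumberTheory.EllipticCurves
  Literature.NumberTheory.EllipticCurves.Rank1Residual
  Summit.BirchSwinnertonDyer.Rank1Residual

namespace Summit.BirchSwinnertonDyer.Uniform.U2

/-! ## §1 `E(ℚ)[2] = 0` in the two currencies, and along a twist -/

section TwoTorsion

/-- `A[2] = ⊥ ⟺ (2 • P = 0 → P = 0)` for an abelian group `A`. [folklore] -/
theorem torsionBy_two_eq_bot_iff {A : Type*} [AddCommGroup A] :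
    A[(2 : ℤ)] = ⊥ ↔ ∀ P : A, 2 • P = 0 → P = 0 := by
  rw [eq_bot_iff]
  constructor
  · intro h P hP
    have hmem : P ∈ A[(2 : ℤ)] := (Submodule.mem_torsionBy_iff _ _).mpr (by
      change (2 : ℤ) • P = 0
      rw [show (2 : ℤ) = ((2 : ℕ) : ℤ) from rfl, natCast_zsmul]; exact hP)
    exact (AddSubgroup.mem_bot).mp (h hmem)
  · intro h P hP
    have h2 : (2 : ℤ) • P = 0 := (Submodule.mem_torsionBy_iff _ _).mp hP
    rw [show (2 : ℤ) = ((2 : ℕ) : ℤ) from rfl, natCast_zsmul] at h2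
    exact (AddSubgroup.mem_bot).mpr (h P h2)

/-- **`E(ℚ)[2] = 0` is twist-invariant**: if `E(ℚ)[2] = 0` and `W'` is any model of `E^{(d)}`
(`C • W' = W.quadraticTwist d`, `d ≠ 0`), then `E^{(d)}(ℚ)[2] = 0` — `E[2] ≅ E^{(d)}[2]` as Galois
modules; in the tree: `Irr · 2` is twist-invariant (`P2.irr_two_iff_of_twist`) and
`Irr W 2 ⟺ (2 • P = 0 → P = 0)` (`X5.O1.irr_two_iff_forall_two_nsmul`). [cite: SilvermanAEC2009, X.5 Cor. 5.4] -/
theorem torsionBy_two_eq_bot_of_twist (W : WeierstrassCurve ℚ) [W.IsElliptic] {d : ℚ} (hd : d ≠ 0)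
    (W' : WeierstrassCurve ℚ) [W'.IsElliptic] (htw : ∃ C : VariableChange ℚ, C • W' = W.quadraticTwist d)
    (hW2 : W.toAffine.Point[(2 : ℤ)] = ⊥) : W'.toAffine.Point[(2 : ℤ)] = ⊥ := by
  rw [torsionBy_two_eq_bot_iff] at hW2 ⊢
  have hirr : Irr W 2 := (X5.O1.irr_two_iff_forall_two_nsmul W).mpr hW2
  have htw' : ∃ C : VariableChange ℚ, C • W.quadraticTwist d = W' := P2.exists_smul_eq_comm.mp htw
  exact (X5.O1.irr_two_iff_forall_two_nsmul W').mp ((P2.irr_two_iff_of_twist W hd htw').mp hirr)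

end TwoTorsion

/-! ## §2 The route-A transport theorem -/

section Transport

variable (W : WeierstrassCurve ℚ) [W.IsElliptic]

/-- **ROUTE A: DIRECT TRANSPORT THROUGH THE PRINTED `2`-ADIC CONTROL THEOREM.** Let `E/ℚ` (model
`W`) have `E(ℚ)[2] = 0`, `Ш(E/ℚ)[2] = 0` and `rank E(ℚ) ≤ 1`; let `d ≠ 1` be square-free and
`F = ℚ(√d)`. REDUCTION-TYPE HYPOTHESES (Mazur–Rubin 2010 Prop. 3.3 over `ℚ`, verbatim): additive
primes of `E` split in `F`; multiplicative primes with `ord_ℓ(Δ_E)` even split in `F`; `2` splits in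
`F`; `F` is real if `Δ_E > 0`; multiplicative primes with `ord_ℓ(Δ_E)` odd are unramified in `F`;
and every prime ramified in `F` has `E(ℚ_q)[2] = 0` (for `q ∤ 2N`: `a_q(E)` odd). INPUT ON THE
TWIST: `Ш(E^{(d)}/ℚ)[2^∞]` finite. THEN, granting Mazur–Rubin Cor. 3.4 (ii) (`hMR`, named fact, as
printed) and the Cassels–Tate pairing (`hCT`, tree named fact): `rank E^{(d)}(ℚ) = rank E(ℚ)` and
`Ш(E^{(d)}/ℚ)[2^∞] = 0`, for every model `W'` of `E^{(d)}`. The Heegner field, the genus character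
and `y_K` do not appear: they live in the finiteness input.
[cite: MazurRubin2010, Cor. 3.4 (ii) with Prop. 3.3] [cite: SilvermanAEC2009, Thm. X.4.2 and X.4.14] -/
theorem routeA_rank_eq_and_sha_two_eq_bot (hMR : MazurRubin2010.cor34ii_rat)
    (hCT : exists_casselsTate_pairing (K := ℚ))
    {d : ℤ} (hd : Squarefree d) (hd1 : d ≠ 1)
    (F : Type) [Field F] [NumberField F] (hF : Module.finrank ℚ F = 2) (hx : ∃ x : F, x ^ 2 = (d : F))
    -- reduction-type hypotheses (MR Prop. 3.3, K = ℚ)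
    (hadd : ∀ (p : ℕ) [Fact p.Prime], ¬ W.HasGoodReductionAtPrime p →
      ¬ W.HasMultiplicativeReductionAtPrime p → ((Ideal.span {(p : ℤ)}).primesOver (𝓞 F)).ncard = 2)
    (hmev : ∀ (p : ℕ) [Fact p.Prime], W.HasMultiplicativeReductionAtPrime p →
      Even (padicValRat p W.Δ) → ((Ideal.span {(p : ℤ)}).primesOver (𝓞 F)).ncard = 2)
    (h2 : ((Ideal.span {(2 : ℤ)}).primesOver (𝓞 F)).ncard = 2)
    (hreal : 0 < W.Δ → NumberField.IsTotallyReal F)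
    (hmodd : ∀ (p : ℕ) [Fact p.Prime], W.HasMultiplicativeReductionAtPrime p →
      Odd (padicValRat p W.Δ) → ¬ (p : ℤ) ∣ NumberField.discr F)
    (hT : ∀ (p : ℕ) [Fact p.Prime], (p : ℤ) ∣ NumberField.discr F →
      ∀ Q : (W.baseChange ℚ_[p]).toAffine.Point, 2 • Q = 0 → Q = 0)
    -- base data
    (hW2 : W.toAffine.Point[(2 : ℤ)] = ⊥) (hWsha : (W.sha)[(2 : ℤ)] = ⊥) (hWr : W.mordellWeilRank ≤ 1)
    -- the twist and its finiteness input
    (W' : WeierstrassCurve ℚ) [W'.IsElliptic]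
    (htw : ∃ C : VariableChange ℚ, C • W' = W.quadraticTwist (d : ℚ))
    (hfin : Finite (AddCommGroup.primaryComponent W'.sha 2)) :
    W'.mordellWeilRank = W.mordellWeilRank ∧ AddCommGroup.primaryComponent W'.sha 2 = ⊥ := by
  have hctrl : Nat.card (W'.selmerGroup 2) = Nat.card (W.selmerGroup 2) :=
    hMR W d hd hd1 F hF hx hadd hmev h2 hreal hmodd hT W' htw
  have hd0 : (d : ℚ) ≠ 0 := by exact_mod_cast hd.ne_zero
  have hV2 : W'.toAffine.Point[(2 : ℤ)] = ⊥ := torsionBy_two_eq_bot_of_twist W hd0 W' htw hW2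
  exact mordellWeilRank_eq_and_sha_two_eq_bot_of_card_selmerGroup_eq W' W hCT hV2 hW2 hWsha hWr
    hfin hctrl

/-- **Variant: a point of infinite order on the twist instead of the finiteness input.** Same
hypotheses, with `Finite Ш(E^{(d)})[2^∞]` replaced by `rank E(ℚ) ≤ rank E^{(d)}(ℚ)` and no bound
on `rank E(ℚ)`; conclusion `rank E^{(d)} = rank E` and `Ш(E^{(d)}/ℚ)[2^∞] = 0` (so finite).
[cite: MazurRubin2010, Cor. 3.4 (ii) with Prop. 3.3] [cite: SilvermanAEC2009, Thm. X.4.2 and X.4.14] -/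
theorem routeA_rank_eq_and_sha_two_eq_bot_of_rank_le (hMR : MazurRubin2010.cor34ii_rat)
    (hCT : exists_casselsTate_pairing (K := ℚ))
    {d : ℤ} (hd : Squarefree d) (hd1 : d ≠ 1)
    (F : Type) [Field F] [NumberField F] (hF : Module.finrank ℚ F = 2) (hx : ∃ x : F, x ^ 2 = (d : F))
    (hadd : ∀ (p : ℕ) [Fact p.Prime], ¬ W.HasGoodReductionAtPrime p →
      ¬ W.HasMultiplicativeReductionAtPrime p → ((Ideal.span {(p : ℤ)}).primesOver (𝓞 F)).ncard = 2)
    (hmev : ∀ (p : ℕ) [Fact p.Prime], W.HasMultiplicativeReductionAtPrime p →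
      Even (padicValRat p W.Δ) → ((Ideal.span {(p : ℤ)}).primesOver (𝓞 F)).ncard = 2)
    (h2 : ((Ideal.span {(2 : ℤ)}).primesOver (𝓞 F)).ncard = 2)
    (hreal : 0 < W.Δ → NumberField.IsTotallyReal F)
    (hmodd : ∀ (p : ℕ) [Fact p.Prime], W.HasMultiplicativeReductionAtPrime p →
      Odd (padicValRat p W.Δ) → ¬ (p : ℤ) ∣ NumberField.discr F)
    (hT : ∀ (p : ℕ) [Fact p.Prime], (p : ℤ) ∣ NumberField.discr F →
      ∀ Q : (W.baseChange ℚ_[p]).toAffine.Point, 2 • Q = 0 → Q = 0)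
    (hW2 : W.toAffine.Point[(2 : ℤ)] = ⊥) (hWsha : (W.sha)[(2 : ℤ)] = ⊥)
    (W' : WeierstrassCurve ℚ) [W'.IsElliptic]
    (htw : ∃ C : VariableChange ℚ, C • W' = W.quadraticTwist (d : ℚ))
    (hrank : W.mordellWeilRank ≤ W'.mordellWeilRank) :
    W'.mordellWeilRank = W.mordellWeilRank ∧ AddCommGroup.primaryComponent W'.sha 2 = ⊥ := by
  have hctrl : Nat.card (W'.selmerGroup 2) = Nat.card (W.selmerGroup 2) :=
    hMR W d hd hd1 F hF hx hadd hmev h2 hreal hmodd hT W' htw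
  have hd0 : (d : ℚ) ≠ 0 := by exact_mod_cast hd.ne_zero
  have hV2 : W'.toAffine.Point[(2 : ℤ)] = ⊥ := torsionBy_two_eq_bot_of_twist W hd0 W' htw hW2
  exact mordellWeilRank_eq_and_sha_two_eq_bot_of_card_selmerGroup_eq_of_rank_le W' W hCT hV2 hW2
    hWsha hrank hctrl

/-- **Rank-zero bases: no finiteness input, no Cassels–Tate.** Under the same control hypotheses,
if `E(ℚ)[2] = 0`, `Ш(E/ℚ)[2] = 0` and `rank E(ℚ) = 0` then `Sel₂(E^{(d)}/ℚ) = 0`, hence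
`rank E^{(d)}(ℚ) = 0` and `Ш(E^{(d)}/ℚ)[2^∞] = 0` outright. (The analytic counterpart — `L(E^{(d)},1)
≠ 0` with `ord₂ = 0` — is Zhai 2016 Thm. 1.1/1.2 for optimal `E` with unit `2`-adic `L`-value.)
[cite: MazurRubin2010, Cor. 3.4 (ii) with Prop. 3.3] [cite: SilvermanAEC2009, Thm. X.4.2] -/
theorem routeA_rank_zero (hMR : MazurRubin2010.cor34ii_rat)
    {d : ℤ} (hd : Squarefree d) (hd1 : d ≠ 1)
    (F : Type) [Field F] [NumberField F] (hF : Module.finrank ℚ F = 2) (hx : ∃ x : F, x ^ 2 = (d : F))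
    (hadd : ∀ (p : ℕ) [Fact p.Prime], ¬ W.HasGoodReductionAtPrime p →
      ¬ W.HasMultiplicativeReductionAtPrime p → ((Ideal.span {(p : ℤ)}).primesOver (𝓞 F)).ncard = 2)
    (hmev : ∀ (p : ℕ) [Fact p.Prime], W.HasMultiplicativeReductionAtPrime p →
      Even (padicValRat p W.Δ) → ((Ideal.span {(p : ℤ)}).primesOver (𝓞 F)).ncard = 2)
    (h2 : ((Ideal.span {(2 : ℤ)}).primesOver (𝓞 F)).ncard = 2)
    (hreal : 0 < W.Δ → NumberField.IsTotallyReal F)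
    (hmodd : ∀ (p : ℕ) [Fact p.Prime], W.HasMultiplicativeReductionAtPrime p →
      Odd (padicValRat p W.Δ) → ¬ (p : ℤ) ∣ NumberField.discr F)
    (hT : ∀ (p : ℕ) [Fact p.Prime], (p : ℤ) ∣ NumberField.discr F →
      ∀ Q : (W.baseChange ℚ_[p]).toAffine.Point, 2 • Q = 0 → Q = 0)
    (hW2 : W.toAffine.Point[(2 : ℤ)] = ⊥) (hWsha : (W.sha)[(2 : ℤ)] = ⊥) (hWr : W.mordellWeilRank = 0)
    (W' : WeierstrassCurve ℚ) [W'.IsElliptic]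
    (htw : ∃ C : VariableChange ℚ, C • W' = W.quadraticTwist (d : ℚ)) :
    W'.mordellWeilRank = 0 ∧ W'.toAffine.Point[(2 : ℤ)] = ⊥ ∧
      AddCommGroup.primaryComponent W'.sha 2 = ⊥ := by
  have hctrl : Nat.card (W'.selmerGroup 2) = Nat.card (W.selmerGroup 2) :=
    hMR W d hd hd1 F hF hx hadd hmev h2 hreal hmodd hT W' htw
  have hW : Nat.card (W.selmerGroup 2) = 1 := by
    rw [natCard_selmerGroup_two_eq W, hWr, hW2, hWsha, pow_zero, AddSubgroup.card_bot,
      AddSubgroup.card_bot, mul_one, mul_one]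
  exact rank_eq_zero_and_sha_two_eq_bot_of_card_selmerGroup_two_eq_one W' (hctrl.trans hW)

end Transport

/-! ## §3 Both members of a genus pair (the rank statement of Theorem A′ under route A) -/

section Pair

/-- **ROUTE A ON BOTH MEMBERS OF A GENUS PAIR (the RANK conclusion of T4-PROOF Theorem A′, reached
through control instead of the genus-point congruence, PLUS `Ш[2^∞] = 0` for both).** Base pair:
`E` (model `W`) and `E^{(D)}` (model `W₀`, `C • W₀ = W.quadraticTwist D`) with `E(ℚ)[2] = 0`,
`Ш(E)[2] = Ш(E^{(D)})[2] = 0` and `rank E + rank E^{(D)} = 1` (Gross–Zagier–Kolyvagin over the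
Heegner field `K = ℚ(√D)` when `y_K` is non-torsion — an INPUT here). Twist pair: `W₁` a model of
`E^{(d)}`, `W₂` a model of `(E^{(D)})^{(d)} = E^{(dD)}`, with the Mazur–Rubin control binders for BOTH
bases at `F = ℚ(√d)` (for `W₀` the additive primes include the primes of `D`, which must therefore
split in `F`: condition (C-p) of T4-PROOF §6 in its first alternative) and the finiteness inputs for
both twists. THEN `rank E^{(d)} = rank E`, `rank E^{(dD)} = rank E^{(D)}`, so the twist pair again
has ranks `{0, 1}` with the SAME distribution as the base pair (`h_∞ = 0`: no flip), and
`Ш(E^{(d)})[2^∞] = Ш(E^{(dD)})[2^∞] = 0`.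
[cite: MazurRubin2010, Cor. 3.4 (ii) with Prop. 3.3] [cite: SilvermanAEC2009, Thm. X.4.2 and X.4.14] -/
theorem routeA_pair (hMR : MazurRubin2010.cor34ii_rat) (hCT : exists_casselsTate_pairing (K := ℚ))
    (W W₀ : WeierstrassCurve ℚ) [W.IsElliptic] [W₀.IsElliptic]
    {D : ℚ} (hD : D ≠ 0) (htw₀ : ∃ C : VariableChange ℚ, C • W₀ = W.quadraticTwist D)
    {d : ℤ} (hd : Squarefree d) (hd1 : d ≠ 1)
    (F : Type) [Field F] [NumberField F] (hF : Module.finrank ℚ F = 2) (hx : ∃ x : F, x ^ 2 = (d : F))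
    (h2 : ((Ideal.span {(2 : ℤ)}).primesOver (𝓞 F)).ncard = 2)
    -- control binders for the base `E`
    (hadd : ∀ (p : ℕ) [Fact p.Prime], ¬ W.HasGoodReductionAtPrime p →
      ¬ W.HasMultiplicativeReductionAtPrime p → ((Ideal.span {(p : ℤ)}).primesOver (𝓞 F)).ncard = 2)
    (hmev : ∀ (p : ℕ) [Fact p.Prime], W.HasMultiplicativeReductionAtPrime p →
      Even (padicValRat p W.Δ) → ((Ideal.span {(p : ℤ)}).primesOver (𝓞 F)).ncard = 2)
    (hreal : 0 < W.Δ → NumberField.IsTotallyReal F)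
    (hmodd : ∀ (p : ℕ) [Fact p.Prime], W.HasMultiplicativeReductionAtPrime p →
      Odd (padicValRat p W.Δ) → ¬ (p : ℤ) ∣ NumberField.discr F)
    (hT : ∀ (p : ℕ) [Fact p.Prime], (p : ℤ) ∣ NumberField.discr F →
      ∀ Q : (W.baseChange ℚ_[p]).toAffine.Point, 2 • Q = 0 → Q = 0)
    -- control binders for the base `E^{(D)}`
    (hadd₀ : ∀ (p : ℕ) [Fact p.Prime], ¬ W₀.HasGoodReductionAtPrime p →
      ¬ W₀.HasMultiplicativeReductionAtPrime p → ((Ideal.span {(p : ℤ)}).primesOver (𝓞 F)).ncard = 2)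
    (hmev₀ : ∀ (p : ℕ) [Fact p.Prime], W₀.HasMultiplicativeReductionAtPrime p →
      Even (padicValRat p W₀.Δ) → ((Ideal.span {(p : ℤ)}).primesOver (𝓞 F)).ncard = 2)
    (hreal₀ : 0 < W₀.Δ → NumberField.IsTotallyReal F)
    (hmodd₀ : ∀ (p : ℕ) [Fact p.Prime], W₀.HasMultiplicativeReductionAtPrime p →
      Odd (padicValRat p W₀.Δ) → ¬ (p : ℤ) ∣ NumberField.discr F)
    (hT₀ : ∀ (p : ℕ) [Fact p.Prime], (p : ℤ) ∣ NumberField.discr F →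
      ∀ Q : (W₀.baseChange ℚ_[p]).toAffine.Point, 2 • Q = 0 → Q = 0)
    -- base data
    (hW2 : W.toAffine.Point[(2 : ℤ)] = ⊥) (hWsha : (W.sha)[(2 : ℤ)] = ⊥) (hW₀sha : (W₀.sha)[(2 : ℤ)] = ⊥)
    (hsum : W.mordellWeilRank + W₀.mordellWeilRank = 1)
    -- the twist pair and its finiteness inputs
    (W₁ W₂ : WeierstrassCurve ℚ) [W₁.IsElliptic] [W₂.IsElliptic]
    (htw₁ : ∃ C : VariableChange ℚ, C • W₁ = W.quadraticTwist (d : ℚ))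
    (htw₂ : ∃ C : VariableChange ℚ, C • W₂ = W₀.quadraticTwist (d : ℚ))
    (hfin₁ : Finite (AddCommGroup.primaryComponent W₁.sha 2))
    (hfin₂ : Finite (AddCommGroup.primaryComponent W₂.sha 2)) :
    W₁.mordellWeilRank = W.mordellWeilRank ∧ W₂.mordellWeilRank = W₀.mordellWeilRank ∧
      W₁.mordellWeilRank + W₂.mordellWeilRank = 1 ∧
      AddCommGroup.primaryComponent W₁.sha 2 = ⊥ ∧ AddCommGroup.primaryComponent W₂.sha 2 = ⊥ := by
  have hW₀2 : W₀.toAffine.Point[(2 : ℤ)] = ⊥ := torsionBy_two_eq_bot_of_twist W hD W₀ htw₀ hW2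
  obtain ⟨h₁, hs₁⟩ := routeA_rank_eq_and_sha_two_eq_bot W hMR hCT hd hd1 F hF hx hadd hmev h2 hreal
    hmodd hT hW2 hWsha (by omega) W₁ htw₁ hfin₁
  obtain ⟨h₂, hs₂⟩ := routeA_rank_eq_and_sha_two_eq_bot W₀ hMR hCT hd hd1 F hF hx hadd₀ hmev₀ h2
    hreal₀ hmodd₀ hT₀ hW₀2 hW₀sha (by omega) W₂ htw₂ hfin₂
  exact ⟨h₁, h₂, by omega, hs₁, hs₂⟩

end Pair

/-! ## §4 Interface with the analytic side: after route A, `BSD(E^{(d)}, 2)` IS «`#Ш_an(E^{(d)})` is a `2`-adic unit» -/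

section Interface

variable (W : WeierstrassCurve ℚ) [W.IsElliptic]

/-- **Finiteness input from the analytic rank** (how route A composes with the genus-point / explicit
Gross–Zagier half of the combination, which ends in `r_an(E^{(d)}) ≤ 1`): Gross–Zagier–Kolyvagin
(tree named fact `rank_eq_analyticRank_of_analyticRank_le_one`, hypothesis `hGZK`) turns
`r_an(E^{(d)}) ≤ 1` into `Finite Ш(E^{(d)})`, hence the finiteness of its `2`-primary part. [cite: Darmon2004, Thm. 3.22] -/
theorem finite_primaryComponent_sha_of_analyticRank_le_one
    (hGZK : rank_eq_analyticRank_of_analyticRank_le_one) (W' : WeierstrassCurve ℚ) [W'.IsElliptic]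
    (hr : W'.analyticRank ≤ 1) : Finite (AddCommGroup.primaryComponent W'.sha 2) := by
  haveI : Finite W'.sha := (hGZK W' hr).2
  infer_instance

/-- **ROUTE A ⇒ the `2`-part of BSD for the twist is EXACTLY the unit statement for `#Ш_an`.** Under
the hypotheses of `routeA_rank_eq_and_sha_two_eq_bot` with the finiteness input supplied as
`r_an(E^{(d)}) ≤ 1` (+ GZK), Miller's `BSD(E^{(d)}, 2)` (`BSDp W' 2`: rank part, `Ш[2^∞]` finite,
`#Ш_an ∈ ℚ` with `ord₂ #Ш_an = ord₂ #Ш[2^∞]`) holds IF AND ONLY IF `#Ш_an(E^{(d)})` (the tree's `shaAn W'`,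
for a globally minimal `W'`) is a rational number of `2`-adic valuation `0` — because route A gives
`Ш(E^{(d)})[2^∞] = 0` and GZK gives the rank part. This is the precise hand-over to the analytic half
(Zhai 2016 for the rank-`0` member: `TransportARankZero`; the Gross–Zagier quotient identity (※※) of
T4-PROOF §5 for the rank-`1` member: seat u2-p2's `CorC`). [cite: Miller2011LMS, Def. 1.1 (arXiv:1010.2431 p. 3)]
[cite: MazurRubin2010, Cor. 3.4 (ii) with Prop. 3.3] -/
theorem routeA_bsdp_two_iff_shaAn_unit (hMR : MazurRubin2010.cor34ii_rat)
    (hCT : exists_casselsTate_pairing (K := ℚ)) (hGZK : rank_eq_analyticRank_of_analyticRank_le_one)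
    {d : ℤ} (hd : Squarefree d) (hd1 : d ≠ 1)
    (F : Type) [Field F] [NumberField F] (hF : Module.finrank ℚ F = 2) (hx : ∃ x : F, x ^ 2 = (d : F))
    (hadd : ∀ (p : ℕ) [Fact p.Prime], ¬ W.HasGoodReductionAtPrime p →
      ¬ W.HasMultiplicativeReductionAtPrime p → ((Ideal.span {(p : ℤ)}).primesOver (𝓞 F)).ncard = 2)
    (hmev : ∀ (p : ℕ) [Fact p.Prime], W.HasMultiplicativeReductionAtPrime p →
      Even (padicValRat p W.Δ) → ((Ideal.span {(p : ℤ)}).primesOver (𝓞 F)).ncard = 2)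
    (h2 : ((Ideal.span {(2 : ℤ)}).primesOver (𝓞 F)).ncard = 2)
    (hreal : 0 < W.Δ → NumberField.IsTotallyReal F)
    (hmodd : ∀ (p : ℕ) [Fact p.Prime], W.HasMultiplicativeReductionAtPrime p →
      Odd (padicValRat p W.Δ) → ¬ (p : ℤ) ∣ NumberField.discr F)
    (hT : ∀ (p : ℕ) [Fact p.Prime], (p : ℤ) ∣ NumberField.discr F →
      ∀ Q : (W.baseChange ℚ_[p]).toAffine.Point, 2 • Q = 0 → Q = 0)
    (hW2 : W.toAffine.Point[(2 : ℤ)] = ⊥) (hWsha : (W.sha)[(2 : ℤ)] = ⊥) (hWr : W.mordellWeilRank ≤ 1)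
    (W' : WeierstrassCurve ℚ) [W'.IsElliptic]
    (htw : ∃ C : VariableChange ℚ, C • W' = W.quadraticTwist (d : ℚ)) (hr : W'.analyticRank ≤ 1) :
    W'.mordellWeilRank = W.mordellWeilRank ∧ W'.analyticRank = W.mordellWeilRank ∧
      AddCommGroup.primaryComponent W'.sha 2 = ⊥ ∧
      (BSDp W' 2 ↔ ∃ q : ℚ, shaAn W' = (q : ℂ) ∧ padicValRat 2 q = 0) := by
  have hfin := finite_primaryComponent_sha_of_analyticRank_le_one hGZK W' hr
  obtain ⟨hrank, hsha⟩ := routeA_rank_eq_and_sha_two_eq_bot W hMR hCT hd hd1 F hF hx hadd hmev h2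
    hreal hmodd hT hW2 hWsha hWr W' htw hfin
  have hra : W'.mordellWeilRank = W'.analyticRank := (hGZK W' hr).1
  refine ⟨hrank, by omega, hsha, ?_⟩
  rw [bsdp_iff]
  constructor
  · rintro ⟨-, -, q, hq, hv⟩
    refine ⟨q, hq, ?_⟩
    rw [hv, hsha, AddSubgroup.card_bot]
    simp
  · rintro ⟨q, hq, hv⟩
    refine ⟨hra, hfin, q, hq, ?_⟩
    rw [hv, hsha, AddSubgroup.card_bot]
    simp

end Interface

end Summit.BirchSwinnertonDyer.Uniform.U2

end
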